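import Summits.BirchSwinnertonDyer.BirchSwinnertonDyer.Theorems.GenusKolyvaginAtTwoOffCutResidualAtTwoRLw2PhantomExclusionWitness
import Summits.BirchSwinnertonDyer.BirchSwinnertonDyer.Theorems.GenusKolyvaginAtTwoPowDvdShaCardAtTwoRTNonPhantomPowAtMultiplicative
import Summits.BirchSwinnertonDyer.BirchSwinnertonDyer.Theorems.GenusKolyvaginAtTwoPowDvdShaCardAtTwoRTNonPhantomHabitat
import HarnessLib

/-!
# Route `GenusKolyvaginAtTwo`, residual `OffCutResidualAtTwoR` (stmt-BirchSwinnertonDyer-31767), LINE 26 «lw2_phantom_exclusion»: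
# THE CUT IS A LEVEL-2 WITNESS — at an odd multiplicative place `v` of a curve with odd Tamagawa product the Lawson–Wuthrich class is NOT
# Kummer over `ℚ_v`; so LINE 26's predicate `LW₂(W)` holds on EVERY cell of the cut, and the cut engine's `(NPh)` is the special case `v` odd
# multiplicative of the level-2 lever

Width seat `bsd-line-gk2-p4` g31 (cell `bsd-f1-sign2`), `--supports stmt-BirchSwinnertonDyer-31767 --as helper`.  THEOREMS ONLY (no
definition, no named fact, no `sorry`).  **BSD is NOT proved by this file; nothing is closed by it alone.**

WHAT.  LINE 26 partitions slice 1 of `OffCutResidualAtTwoR` by the decidable predicate `LW₂(W)` := «some place `v ∋ N` of `ℚ` at which no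
non-zero class of `H¹(ℚ, E[2])` dying on `Γ_{ℚ(E[4])}` is Kummer»; its instrument (kit j339762) found the witness at the odd multiplicative prime on
ALL 60 control cells of the CUT.  This file makes that control a theorem:
* ★ `levelTwoWitness_rat_of_hasMultiplicativeReductionAt` — `E/ℚ` with `ρ̄_{E,2}`, `ρ̄_{E,4}` onto and `Odd (∏ c_p)`, `v ∤ 2` of multiplicative
  reduction: no non-zero class of `H¹(ℚ, E[2])` dying on `Γ_{ℚ(E[4])}` is Kummer at `ℚ_v`.  Proof: lift by `ι_{1→2}` (injective, `E(ℚ)[2] = 0`) to a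
  phantom class of `H¹(ℚ, E[4])` Kummer at `v`, which gk2-p3 g22's level-`2^L` non-phantom lemma at an odd multiplicative place
  (`NonPhantomPow.eq_zero_of_h1Eval_eq_zero_of_mem_selmerLocalKer_pow`, `L = 2`, over the field `ℚ`; `ord_v Δ_min` odd from `Odd (∏ c_p)`,
  `NonPhantom.odd_ordMinimalDiscriminant_of_odd_tamagawaProduct`) kills.
* `exists_levelTwoWitness_rat_of_cut` — the same packaged as LINE 26's `LW₂(W)` clause (the `hLW` case split of `OffCutResidualAtTwoR_of`): the
  cut's binder quadruple `(v, 2 ∉ v, N ∈ v, multiplicative)` ⟹ `LW₂(W)`.  READING for the pen: the engine branch of LINE 26 CONTAINS the cut's — a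
  restated `closes` needs ONE engine branch (`LW₂`), the multiplicative branch being its special case.
* `nonPhantom_baseChange_of_cut` — consistency corollary: cut ⟹ `LW₂` ⟹ (this seat's `levelTwoWitness_baseChange_of_rat`, Heegner transport) a
  `K`-witness ⟹ (this seat's `nonPhantom_baseChange_of_levelTwoWitness`) `(NPh_M)` for every `M ≥ 1` — LINE 18's displayed hypothesis re-derived
  through the level-2 lever, in the binders of the LINE 26 skeleton (same content as gk2-p3's `NonPhantomPow.nonPhantomAtTwo_of_hasMultiplicativeReductionAt`,
  different road).
BSD is NOT proved by any of this.

References: [LawsonWuthrich2016] §3 (Lemma 6, Thm. 1), §7.1, §8; [GrossLMS1991] §9 Prop. 9.1; [SilvermanATAEC1994] IV.9.2 (d), V Ex. 5.13 (b);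
[McCallumLMS1991] §4 (5).
-/

set_option autoImplicit false
-- the Theorems namespace of this sub repeats the summit name by design (D-0017 nested layout)
set_option linter.dupNamespace false

noncomputable section

open scoped Classical NumberField

namespace Summit.BirchSwinnertonDyer.BirchSwinnertonDyer.Theorems.GenusExact.Lw2PhantomExclusion

open WeierstrassCurve NumberField Field IsDedekindDomain
open Literature.NumberTheory.EllipticCurves Literature.NumberTheory.GaloisRepresentations
open Summit.BirchSwinnertonDyer.BirchSwinnertonDyer.Theorems.KolyvaginLowerBoundAtTwo (torsionFixing_le_of_dvd)

variable (W : WeierstrassCurve ℚ) [W.IsElliptic]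

/-! ## §1 An odd multiplicative place is a level-2 witness over `ℚ` -/

/-- ★ **THE CUT IS A LEVEL-2 WITNESS.**  `E/ℚ` elliptic with `ρ̄_{E,2}` and `ρ̄_{E,4}` onto, `v ∤ 2` a place of multiplicative reduction with
`ord_v Δ_min` odd: no non-zero class of `H¹(ℚ, E[2])` dying on `Γ_{ℚ(E[4])}` satisfies the Kummer (Selmer) condition at `ℚ_v`.  Lift by `ι_{1→2}`
(injective as `E(ℚ)[2] = 0`): a phantom class of `H¹(ℚ, E[4])` (`[ι_* z, ρ] = [z, ρ]`), Kummer at `v` (level-stability of the Selmer local condition),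
is `0` by the level-`4` non-phantom lemma at an odd multiplicative place (inertial Tate transvection; `NonPhantomPow.eq_zero_of_h1Eval_eq_zero_of_mem_selmerLocalKer_pow`).
[cite: LawsonWuthrich2016, §7.1 and §8] [cite: SilvermanATAEC1994, Exercise 5.13 (b) and Cor. IV.9.2 (d)] [cite: McCallumLMS1991, §4 (5)] -/
theorem levelTwoWitness_rat_of_hasMultiplicativeReductionAt_of_odd
    (hρ2 : W.HasSurjectiveModNGaloisRep 2) (hρ4 : W.HasSurjectiveModNGaloisRep 4)
    {v : HeightOneSpectrum (𝓞 ℚ)} (h2v : ((2 : ℕ) : 𝓞 ℚ) ∉ v.asIdeal) (hmult : W.HasMultiplicativeReductionAt v)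
    (hodd : Odd (W.ordMinimalDiscriminant v)) :
    ∀ z : galH1Torsion W 2, z ≠ 0 → (∀ ρ ∈ torsionFixing W 4, h1Eval W 2 z ρ = 0) →
      z ∉ selmerLocalKer W (v.adicCompletion ℚ) 2 := by
  intro z hz0 hz hzv
  have h12 : (2 : ℤ) ∣ ((2 ^ 2 : ℕ) : ℤ) := ⟨2, by norm_num⟩
  have hinj : Function.Injective (torsionH1OfDvd W h12) :=
    VisiblePairAtTwo.torsionH1OfDvd_pow_injective W (p := 2) (a := 1) (j := 2)
      (VisiblePairAtTwo.torsionBy_two_eq_bot_of_surj W hρ2) _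
  have hρ4' : W.HasSurjectiveModNGaloisRep ((2 ^ 2 : ℕ) : ℤ) := by
    have e : ((2 ^ 2 : ℕ) : ℤ) = 4 := by norm_num
    rw [e]
    exact hρ4
  have hz4 : ∀ ρ ∈ torsionFixing W ((2 ^ 2 : ℕ) : ℤ), h1Eval W (2 : ℤ) z ρ = 0 := by
    have e : ((2 ^ 2 : ℕ) : ℤ) = 4 := by norm_num
    rw [e]
    exact hz
  have hιz : ∀ ρ ∈ torsionFixing W ((2 ^ 2 : ℕ) : ℤ), h1Eval W _ (torsionH1OfDvd W h12 z) ρ = 0 :=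
    fun ρ hρ' ↦ (h1Eval_torsionH1OfDvd_eq_zero_iff W h12 z hρ').mpr (hz4 ρ hρ')
  have hιv : torsionH1OfDvd W h12 z ∈ selmerLocalKer W (v.adicCompletion ℚ) ((2 ^ 2 : ℕ) : ℤ) :=
    (RelaxedCount.torsionH1OfDvd_mem_selmerLocalKer_iff_mem W h12 (v.adicCompletion ℚ) z).mpr hzv
  have hι0 : torsionH1OfDvd W h12 z = 0 :=
    NonPhantomPow.eq_zero_of_h1Eval_eq_zero_of_mem_selmerLocalKer_pow W hmult h2v hodd (L := 2) (by norm_num) rfl hρ4' hιz hιv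
  exact hz0 (hinj (by rw [hι0, map_zero]))

/-- ★ **THE CUT IS A LEVEL-2 WITNESS, habitat form**: `E/ℚ` elliptic with `Odd (∏ c_p)` (so `ord_v Δ_min` is odd at every multiplicative `v`,
`NonPhantom.odd_ordMinimalDiscriminant_of_odd_tamagawaProduct`) and `ρ̄_{E,2^n}` onto for all `n ≥ 1`; `v ∤ 2` multiplicative: no non-zero class of
`H¹(ℚ, E[2])` dying on `Γ_{ℚ(E[4])}` is Kummer at `ℚ_v`.  This is LINE 26's instrument CONTROL (kit j339762: on all 60 cut cells the witness set contains
the odd multiplicative prime) as a theorem. [cite: LawsonWuthrich2016, §7.1 and §8] [cite: SilvermanATAEC1994, Cor. IV.9.2 (d)] -/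
theorem levelTwoWitness_rat_of_hasMultiplicativeReductionAt
    (hT : Odd W.tamagawaProduct) (hρ : ∀ n : ℕ, 0 < n → W.HasSurjectiveModNGaloisRep ((2 : ℤ) ^ n))
    {v : HeightOneSpectrum (𝓞 ℚ)} (h2v : ((2 : ℕ) : 𝓞 ℚ) ∉ v.asIdeal) (hmult : W.HasMultiplicativeReductionAt v) :
    ∀ z : galH1Torsion W 2, z ≠ 0 → (∀ ρ ∈ torsionFixing W 4, h1Eval W 2 z ρ = 0) →
      z ∉ selmerLocalKer W (v.adicCompletion ℚ) 2 := by
  have hρ2 : W.HasSurjectiveModNGaloisRep 2 := by simpa using hρ 1 one_pos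
  have hρ4 : W.HasSurjectiveModNGaloisRep 4 := by have h := hρ 2 two_pos; norm_num at h; exact h
  exact levelTwoWitness_rat_of_hasMultiplicativeReductionAt_of_odd W hρ2 hρ4 h2v hmult
    (NonPhantom.odd_ordMinimalDiscriminant_of_odd_tamagawaProduct W hT hmult)

/-! ## §2 LINE 26's predicate `LW₂(W)` on the cut -/

/-- **Cut ⟹ `LW₂(W)`** in the exact shape of the `hLW` case split of LINE 26's composition `OffCutResidualAtTwoR_of`: the cut's binder quadruple
`(v, 2 ∉ v, N ∈ v, multiplicative at v)` supplies the witness place `v ∋ N`.  READING for the pen: LINE 26's engine branch contains the cut's.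
[cite: LawsonWuthrich2016, §7.1 and §8] -/
theorem exists_levelTwoWitness_rat_of_cut [W.IsGloballyMinimal]
    (hT : Odd W.tamagawaProduct) (hρ : ∀ n : ℕ, 0 < n → W.HasSurjectiveModNGaloisRep ((2 : ℤ) ^ n))
    (hcut : ∃ v : HeightOneSpectrum (𝓞 ℚ), ((2 : ℕ) : 𝓞 ℚ) ∉ v.asIdeal ∧
      ((W.conductorNorm ℤ : ℕ) : 𝓞 ℚ) ∈ v.asIdeal ∧ W.HasMultiplicativeReductionAt v) :
    ∃ v : HeightOneSpectrum (𝓞 ℚ), ((W.conductorNorm ℤ : ℕ) : 𝓞 ℚ) ∈ v.asIdeal ∧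
      (∀ z : galH1Torsion W 2, z ≠ 0 → (∀ ρ ∈ torsionFixing W 4, h1Eval W 2 z ρ = 0) →
        z ∉ selmerLocalKer W (v.adicCompletion ℚ) 2) := by
  obtain ⟨v, h2v, hNv, hmult⟩ := hcut
  exact ⟨v, hNv, levelTwoWitness_rat_of_hasMultiplicativeReductionAt W hT hρ h2v hmult⟩

/-! ## §3 Consistency: the cut engine's `(NPh_M)` through the level-2 lever -/

/-- **`(NPh_M)` on the cut, every `M ≥ 1`, THROUGH THE LEVEL-2 LEVER** (binders of the LINE 26 skeleton): cut ⟹ `LW₂(W)` (§2) ⟹ a `K`-witness at a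
place `w₀ ∋ 2N` of the Heegner field (`levelTwoWitness_baseChange_of_rat` = `stub_transport`) ⟹ `(NPh_M)` (`nonPhantom_baseChange_of_levelTwoWitness` =
`stub_KLW`).  Same content as gk2-p3 g22's `NonPhantomPow.nonPhantomAtTwo_of_hasMultiplicativeReductionAt` (LINE 18), by a different road; recorded to
certify that LINE 26's engine branch subsumes the cut's.  BSD is NOT proved by this. [cite: LawsonWuthrich2016, §7.1 and §8] [cite: GrossLMS1991, §9 Prop. 9.1] -/
theorem nonPhantom_baseChange_of_cut [W.IsGloballyMinimal] [NeZero (W.conductorNorm ℤ)]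
    (hT : Odd W.tamagawaProduct) (hρ : ∀ n : ℕ, 0 < n → W.HasSurjectiveModNGaloisRep ((2 : ℤ) ^ n))
    (K : Type) [Field K] [NumberField K] (hK : IsImaginaryQuadratic K) (hodd : Odd (NumberField.discr K))
    (hH : SatisfiesHeegnerHypothesis (W.conductorNorm ℤ) K)
    (hnsq₁ : ¬ IsSquare ((NumberField.discr K : ℚ) * -|W.Δ|)) (hnsq₂ : ¬ IsSquare ((NumberField.discr K : ℚ) * (-(2 * |W.Δ|))))
    (hcut : ∃ v : HeightOneSpectrum (𝓞 ℚ), ((2 : ℕ) : 𝓞 ℚ) ∉ v.asIdeal ∧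
      ((W.conductorNorm ℤ : ℕ) : 𝓞 ℚ) ∈ v.asIdeal ∧ W.HasMultiplicativeReductionAt v) :
    ∀ (Mlev : ℕ), 1 ≤ Mlev → ∀ z : galH1Torsion (W.baseChange K) ((2 ^ Mlev : ℕ) : ℤ),
      (∀ ρ ∈ torsionFixing (W.baseChange K) ((2 ^ Mlev : ℕ) : ℤ), h1Eval (W.baseChange K) ((2 ^ Mlev : ℕ) : ℤ) z ρ = 0) →
      (∀ w : HeightOneSpectrum (𝓞 K), ((2 * W.conductorNorm ℤ : ℕ) : 𝓞 K) ∈ w.asIdeal →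
        z ∈ selmerLocalKer (W.baseChange K) (w.adicCompletion K) ((2 ^ Mlev : ℕ) : ℤ)) → z = 0 := by
  obtain ⟨w₀, hw₀, hwit⟩ := levelTwoWitness_baseChange_of_rat W hT hρ K hK hodd hH hnsq₁ hnsq₂
    (exists_levelTwoWitness_rat_of_cut W hT hρ hcut)
  exact nonPhantom_baseChange_of_levelTwoWitness W hT hρ K hK hodd hH hnsq₁ hnsq₂ w₀ hw₀ hwit

end Summit.BirchSwinnertonDyer.BirchSwinnertonDyer.Theorems.GenusExact.Lw2PhantomExclusion

end
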